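import Summits.BirchSwinnertonDyer.BirchSwinnertonDyer.Theorems.ClassRecordThreeRung62310y1HeightEvalFormalLog
import Summits.BirchSwinnertonDyer.BirchSwinnertonDyer.Theorems.ClassRecordThreeRegCertKernelLog
import HarnessLib

/-!
# Route `ClassRecordThree`, crux `SchneiderAtThree` (item 19106): THIRD-ORDER ingredient of the REG3CERT kernel evaluator —
# the formal logarithm to its quartic term: `coeff 6 w = a₁³ + 2a₁a₂ + a₃`, `coeff 3 ω = a₁³ + 2a₁a₂ + 2a₃`,
# `coeff 4 log_W = (a₁³ + 2a₁a₂ + 2a₃)/4`, and `‖log_W(z) − quartic‖₃ ≤ 3⁻⁵` on `‖z‖ ≤ 3⁻¹`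
# (cell `bsd-stepL`, seat `bsd-stepL-reg3-eng` g3; `--supports stmt-BirchSwinnertonDyer-19106`)

HONEST FRAMING: BSD is not proved by any of this; pure formal-group algebra plus one `3`-adic tail bound, no statement about any
curve. Extends `…Rung62310y1HeightEvalFormalLog` (p426807: degrees `≤ 5` of `w`, `≤ 2` of `ω`, `≤ 3` of `log_W`) by one
degree, as needed for `h mod 81` (REG3CERT rows with `v₃(h(Q)) = 3`). Theorems only (0 defs, 0 facts).
References: [SilvermanAEC2009] IV.1.1, IV.5.5, IV.6.3–6.4.
-/

open scoped Classical

open PowerSeries Literature.NumberTheory.EllipticCurves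
  Summit.BirchSwinnertonDyer.Rank1Residual.X11b.RegMult.Rung62310y1

namespace Summit.BirchSwinnertonDyer.Rank1Residual.X11b.RegMult.KernelCert

/-! ### §1 `coeff 6 w(z) = a₁³ + 2a₁a₂ + a₃` -/

section Ring

variable {R : Type*} [CommRing R] (W : WeierstrassCurve R)

/-- The iterates `fᵐ(0)` have `coeff 6 = a₁³ + 2a₁a₂ + a₃` for `m ≥ 3`. [Silverman AEC IV.1.1(a)] [cite: SilvermanAEC2009, IV.1.1] -/
theorem coeff_six_iterate_formalWStep (m : ℕ) (hm : 3 ≤ m) :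
    coeff 6 ((W.formalWStep)^[m + 1] 0) = W.a₁ ^ 3 + 2 * W.a₁ * W.a₂ + W.a₃ := by
  obtain ⟨k, rfl⟩ : ∃ k, m = k + 1 := ⟨m - 1, by omega⟩
  obtain ⟨h3, h4, h5⟩ := coeff_iterate_formalWStep W k
  obtain ⟨u, hu⟩ := W.X_pow_three_dvd_iterate_formalWStep (k + 1)
  have hu0 : coeff 0 u = 1 := by
    have := h3; rw [hu, coeff_X_pow_mul'] at this; simpa using this
  have hu1 : coeff 1 u = W.a₁ := by
    have := h4 (by omega); rw [hu, coeff_X_pow_mul'] at this; simpa using this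
  have hu2 : coeff 2 u = W.a₁ ^ 2 + W.a₂ := by
    have := h5 (by omega); rw [hu, coeff_X_pow_mul'] at this; simpa using this
  have hstep : (W.formalWStep)^[k + 1 + 1] 0 = W.formalWStep (X ^ 3 * u) := by
    rw [Function.iterate_succ_apply', hu]
  rw [hstep, W.formalWStep_X_pow_mul, map_add, coeff_X_pow_mul', coeff_X_pow]
  simp only [show ¬ (6 : ℕ) = 3 by norm_num, if_false, show (4 : ℕ) ≤ 6 by norm_num, if_true, zero_add,
    show (6 : ℕ) - 4 = 2 by norm_num, map_add, mul_assoc, coeff_C_mul, coeff_succ_X_mul, coeff_X_pow_mul']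
  simp [hu0, hu1, hu2, pow_two, coeff_mul]
  ring

/-- `coeff 6 w(z) = a₁³ + 2a₁a₂ + a₃`. [Silverman AEC IV.1.1(a)] [cite: SilvermanAEC2009, IV.1.1] -/
theorem coeff_six_formalW : coeff 6 W.formalW = W.a₁ ^ 3 + 2 * W.a₁ * W.a₂ + W.a₃ := by
  rw [WeierstrassCurve.formalW, coeff_mk]
  exact coeff_six_iterate_formalWStep W 5 (by norm_num)

/-- `coeff 3 B = a₁³ + 2a₁a₂ + a₃` for `B = w/z³`. [Silverman AEC IV.1.1(a)] [cite: SilvermanAEC2009, IV.1.1] -/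
theorem coeff_three_formalWDivCube : coeff 3 W.formalWDivCube = W.a₁ ^ 3 + 2 * W.a₁ * W.a₂ + W.a₃ := by
  rw [WeierstrassCurve.formalWDivCube, coeff_mk]; exact coeff_six_formalW W

end Ring

/-! ### §2 `coeff 3 ω = a₁³ + 2a₁a₂ + 2a₃` and `coeff 4 log_W` -/

section RatAlgebra

variable {A : Type*} [CommRing A] [Algebra ℚ A] (W : WeierstrassCurve A)

omit [Algebra ℚ A] in
/-- Coefficients `0 … 3` of the denominator `D = B·(2 − a₁z − a₃z³B)` of `ω`: `2, a₁, a₁² + 2a₂, a₁³ + 3a₁a₂ + a₃`. [folklore] -/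
private theorem coeff_formalOmegaDenom₃ :
    coeff 0 (W.formalWDivCube * (2 - C W.a₁ * X - C W.a₃ * X ^ 3 * W.formalWDivCube)) = 2 ∧
    coeff 1 (W.formalWDivCube * (2 - C W.a₁ * X - C W.a₃ * X ^ 3 * W.formalWDivCube)) = W.a₁ ∧
    coeff 2 (W.formalWDivCube * (2 - C W.a₁ * X - C W.a₃ * X ^ 3 * W.formalWDivCube)) = W.a₁ ^ 2 + 2 * W.a₂ ∧
    coeff 3 (W.formalWDivCube * (2 - C W.a₁ * X - C W.a₃ * X ^ 3 * W.formalWDivCube)) =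
      W.a₁ ^ 3 + 3 * W.a₁ * W.a₂ + W.a₃ := by
  have hD : W.formalWDivCube * (2 - C W.a₁ * X - C W.a₃ * X ^ 3 * W.formalWDivCube) =
      C (2 : A) * W.formalWDivCube - C W.a₁ * (X * W.formalWDivCube) -
        C W.a₃ * (X ^ 3 * (W.formalWDivCube * W.formalWDivCube)) := by
    rw [map_ofNat]; ring
  have h0 : coeff 0 W.formalWDivCube = 1 := by
    rw [coeff_zero_eq_constantCoeff]; exact W.constantCoeff_formalWDivCube
  have hsq : coeff 0 (W.formalWDivCube * W.formalWDivCube) = 1 := by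
    rw [PowerSeries.coeff_mul]; simp [h0]
  rw [hD]
  refine ⟨?_, ?_, ?_, ?_⟩
  · simp only [map_sub, coeff_C_mul, coeff_zero_X_mul, coeff_X_pow_mul', h0]; simp
  · simp only [map_sub, coeff_C_mul, coeff_succ_X_mul, coeff_X_pow_mul', h0, (coeff_one_formalWDivCube W)]
    simp; ring
  · simp only [map_sub, coeff_C_mul, coeff_succ_X_mul, coeff_X_pow_mul', (coeff_one_formalWDivCube W),
      (coeff_two_formalWDivCube W)]
    simp; ring
  · simp only [map_sub, coeff_C_mul, coeff_succ_X_mul, coeff_X_pow_mul', (coeff_two_formalWDivCube W),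
      (coeff_three_formalWDivCube W), hsq]
    simp; ring

/-- **`coeff 3 ω = a₁³ + 2a₁a₂ + 2a₃`** (degree-3 coefficients in `ω·D = 2B + zB′`). [Silverman AEC IV.1]
[cite: SilvermanAEC2009, IV.1.1] -/
theorem coeff_three_formalOmega : coeff 3 W.formalOmega = W.a₁ ^ 3 + 2 * W.a₁ * W.a₂ + 2 * W.a₃ := by
  have h := congrArg (coeff 3) W.formalOmega_mul_denom
  obtain ⟨d0, d1, d2, d3⟩ := coeff_formalOmegaDenom₃ W
  have hω0 : coeff 0 W.formalOmega = 1 := by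
    rw [coeff_zero_eq_constantCoeff]; exact W.constantCoeff_formalOmega
  have hω1 := coeff_one_formalOmega W
  have hω2 := coeff_two_formalOmega W
  rw [PowerSeries.coeff_mul, Finset.Nat.sum_antidiagonal_succ, Finset.Nat.sum_antidiagonal_succ,
    Finset.Nat.sum_antidiagonal_succ] at h
  simp only [Finset.Nat.antidiagonal_zero, Finset.sum_singleton, zero_add] at h
  rw [hω0, hω1, hω2, d3, d2, d1, d0, map_add,
    show (2 : A⟦X⟧) * W.formalWDivCube = C (2 : A) * W.formalWDivCube by rw [map_ofNat], coeff_C_mul,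
    (coeff_three_formalWDivCube W), coeff_succ_X_mul, coeff_derivative, (coeff_three_formalWDivCube W)] at h
  have h2 : IsUnit (2 : A) := ⟨WeierstrassCurve.unitTwo, rfl⟩
  refine h2.mul_left_cancel ?_
  have : (2 : A) * coeff 3 W.formalOmega = coeff 3 W.formalOmega * 2 := mul_comm _ _
  rw [this]
  push_cast at h
  linear_combination h

/-- **`coeff 4 log_W = (a₁³ + 2a₁a₂ + 2a₃)/4`** (`log_W = ∫ ω`). [Silverman AEC IV.5.5] [cite: SilvermanAEC2009, IV.5.5] -/
theorem coeff_four_formalLog :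
    coeff 4 W.formalLog = algebraMap ℚ A (1 / 4) * (W.a₁ ^ 3 + 2 * W.a₁ * W.a₂ + 2 * W.a₃) := by
  rw [WeierstrassCurve.formalLog, coeff_mk]
  show algebraMap ℚ A (1 / ((2 : ℕ) + 2 : ℚ)) * coeff (2 + 1) W.formalOmega = _
  rw [coeff_three_formalOmega W]; norm_num

end RatAlgebra

/-! ### §3 Over `ℚ₃`: `log_W(z)` modulo `O(3⁻⁵)` for `‖z‖ ≤ 3⁻¹` -/

section Padic

variable (V : WeierstrassCurve ℚ_[3]) [V.IsIntegral ℤ_[3]]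

/-- `n + 7 ≤ 3^{n+2}`. [folklore] -/
private theorem add_seven_le_three_pow (n : ℕ) : n + 7 ≤ 3 ^ (n + 2) := by
  induction n with
  | zero => norm_num
  | succ k ih => have h : 3 ^ (k + 1 + 2) = 3 * 3 ^ (k + 2) := by ring
                 omega

/-- `‖1/(n+5)‖₃ ≤ 3ⁿ` (`5` is a unit, `‖1/6‖ = 3`, `‖1/m‖ ≤ m ≤ 3^{m−5}` for `m ≥ 7`). [folklore] -/
private theorem norm_inv_natCast_add_five_le (n : ℕ) : ‖(((n + 5 : ℕ) : ℚ_[3]))⁻¹‖ ≤ (3 : ℝ) ^ n := by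
  rcases Nat.lt_or_ge n 2 with hn | hn
  · interval_cases n
    · have : ‖(((0 + 5 : ℕ) : ℚ_[3]))⁻¹‖ = 1 := by
        rw [norm_inv, Padic.norm_eq_zpow_neg_valuation (by norm_num), Padic.valuation_natCast,
          padicValNat.eq_zero_of_not_dvd (by norm_num)]; simp
      rw [this]; norm_num
    · have : ‖(((1 + 5 : ℕ) : ℚ_[3]))⁻¹‖ = 3 := by
        rw [show ((1 + 5 : ℕ) : ℚ_[3]) = 2 * 3 by norm_num, mul_inv, norm_mul, norm_inv, norm_inv,
          show (2 : ℚ_[3]) = ((2 : ℤ) : ℚ_[3]) by norm_cast, norm_intCast_eq_one_of_not_dvd (by decide),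
          show (3 : ℚ_[3]) = ((3 : ℕ) : ℚ_[3]) by norm_cast, Padic.norm_p]; norm_num
      rw [this]; norm_num
  · obtain ⟨k, rfl⟩ : ∃ k, n = k + 2 := ⟨n - 2, by omega⟩
    have hm : ‖(((k + 2 + 5 : ℕ) : ℚ_[3]))⁻¹‖ ≤ ((k + 2 + 5 : ℕ) : ℝ) := padic_norm_inv_natCast_le _
    have hpow : ((k + 2 + 5 : ℕ) : ℝ) ≤ (3 : ℝ) ^ (k + 2) := by
      have := add_seven_le_three_pow k
      rw [show k + 2 + 5 = k + 7 by ring]; exact_mod_cast this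
    exact hm.trans hpow

/-- The terms of degree `≥ 5` of `log_W(z)` have norm `≤ 3⁻⁵` for `‖z‖₃ ≤ 3⁻¹`. [cite: SilvermanAEC2009, IV.6.3] -/
private theorem norm_formalLog_term_le₅ {z : ℚ_[3]} (hz : ‖z‖ ≤ 1 / 3) (n : ℕ) :
    ‖coeff (n + 5) V.formalLog * z ^ (n + 5)‖ ≤ 1 / 243 := by
  rw [norm_mul, norm_pow]
  have hc := norm_coeff_formalLog_le_norm_inv V (n + 3)
  rw [show n + 3 + 2 = n + 5 by ring] at hc
  calc ‖coeff (n + 5) V.formalLog‖ * ‖z‖ ^ (n + 5) ≤ (3 : ℝ) ^ n * (1 / 3 : ℝ) ^ (n + 5) := by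
        gcongr; exact hc.trans (norm_inv_natCast_add_five_le n)
    _ = ((3 : ℝ) ^ n * (1 / 3 : ℝ) ^ n) * (1 / 243) := by ring
    _ = 1 / 243 := by rw [← mul_pow]; norm_num

/-- **`log_W(z) = z + (a₁/2)z² + ((a₁²+a₂)/3)z³ + ((a₁³+2a₁a₂+2a₃)/4)z⁴ + O(3⁻⁵)` on `‖z‖₃ ≤ 3⁻¹`** for a
`3`-integral equation over `ℚ₃`. [cite: SilvermanAEC2009, IV.6.4] -/
theorem norm_padicFormalLog_sub_quartic_le {z : ℚ_[3]} (hz : ‖z‖ ≤ 1 / 3) :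
    ‖V.padicFormalLog z - (z + (2 : ℚ_[3])⁻¹ * V.a₁ * z ^ 2 + (3 : ℚ_[3])⁻¹ * (V.a₁ ^ 2 + V.a₂) * z ^ 3 +
      (4 : ℚ_[3])⁻¹ * (V.a₁ ^ 3 + 2 * V.a₁ * V.a₂ + 2 * V.a₃) * z ^ 4)‖ ≤ 1 / 243 := by
  have hs := V.summable_formalLog_of_isIntegral z (hz.trans_lt (by norm_num))
  have hsplit := hs.sum_add_tsum_nat_add 5
  have h0 : coeff 0 V.formalLog = 0 := by rw [coeff_zero_eq_constantCoeff]; exact V.constantCoeff_formalLog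
  have h2 : coeff 2 V.formalLog = (2 : ℚ_[3])⁻¹ * V.a₁ := by
    rw [(coeff_two_formalLog V), eq_ratCast]; push_cast; ring
  have h3 : coeff 3 V.formalLog = (3 : ℚ_[3])⁻¹ * (V.a₁ ^ 2 + V.a₂) := by
    rw [(coeff_three_formalLog V), eq_ratCast]; push_cast; ring
  have h4 : coeff 4 V.formalLog = (4 : ℚ_[3])⁻¹ * (V.a₁ ^ 3 + 2 * V.a₁ * V.a₂ + 2 * V.a₃) := by
    rw [(coeff_four_formalLog V), eq_ratCast]; push_cast; ring
  have hfive : ∑ i ∈ Finset.range 5, coeff i V.formalLog * z ^ i =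
      z + (2 : ℚ_[3])⁻¹ * V.a₁ * z ^ 2 + (3 : ℚ_[3])⁻¹ * (V.a₁ ^ 2 + V.a₂) * z ^ 3 +
        (4 : ℚ_[3])⁻¹ * (V.a₁ ^ 3 + 2 * V.a₁ * V.a₂ + 2 * V.a₃) * z ^ 4 := by
    simp only [Finset.sum_range_succ, Finset.sum_range_zero, h0, V.coeff_one_formalLog, h2, h3, h4]
    ring
  rw [WeierstrassCurve.padicFormalLog, ← hsplit, hfive, add_sub_cancel_left]
  exact IsUltrametricDist.norm_tsum_le_of_forall_le_of_nonneg (by norm_num) fun n ↦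
    norm_formalLog_term_le₅ V hz n

end Padic

end Summit.BirchSwinnertonDyer.Rank1Residual.X11b.RegMult.KernelCert
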